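import Summits.PneNP.PneNP.Theses.KarlinRubin
import Summits.PneNP.PneNP.Theorems.KarlinRubinMonotoneBlindStubWeakBlindDnfCount
import Summits.PneNP.PneNP.Theorems.KarlinRubinMonotoneBlindDepth3Blind

/-!
# Crux `MonotoneBlind` (stmt-PneNP-18027, route KarlinRubin), line `Sketch`: stub `stub_weakBlindDnf`

**Weak blindness of EVERY polynomial-term monotone DNF (no quietness).** For `0 < δ < 1/2`, `c : ℕ` and term
families `𝓔 n` (a monotone DNF on the edge slots of `Kₙ` accepts `x` iff `∃ E ∈ 𝓔 n, E ⊆ x`) with `#(𝓔 n) ≤ n^c`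
eventually:

  `Pr_{G(n,1/2,⌈n^{1/2-δ}⌉)}[∃ E ⊆ y] ≤ Pr_{G(n,1/2)}[∃ E ⊆ x] + ε n` eventually, `ε n → 0`

(`stub_weakBlindDnf`, the registered stub of line `Sketch` of the crux, with `ε n = 1/n`; the truth is
`n^{-1-2δ+o(1)}`, tight for a single edge). Unlike `karlinRubin_dnf_planted_tendsto_zero` no quietness is assumed:
the planted-minus-null advantage is the `(A, x)`-average of `[x rejected ∧ plant A x accepted]`, and at EVERY
failure point `x` the completing planted sets are covered through the inclusion-MINIMAL missing vertex sets
(counting core `KarlinRubinMonotoneBlindStubWeakBlindDnfCount.lean`: cover, fibre factor `(d/n)^{|U|}`, and the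
pair count by the injection `(x, U) ↦ (x ∪ (E_U ∖ x), E_U ∖ x)`, polylogarithmic on average).

* `sum_card_adv_mul_le` — the advantage count at one `n` under numeric hypotheses `H1`–`H3`:
  `T · n ≤ #kSubsets · #EdgeVec`;
* `planted_le_null_add_adv`, `adv_le_inv_of_count` — counts to probabilities (`ℝ≥0∞`);
* `weakBlindDnf_H3`, `eventually_weakBlindDnf_H2`, `eventually_weakBlindDnf_H1` — the numeric hypotheses for
  `k = ⌈n^{1/2-δ}⌉`, `w = (c + 2r)(⌊log₂ n⌋ + 1)`, `r = C(2c+2, 2)` (from `C (log n)^a n^α ≤ n^β` eventually);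
* `stub_weakBlindDnf` — the theorem.

All `--supports stmt-PneNP-18027`; no definitions.
-/

set_option linter.dupNamespace false -- `Summit.PneNP.PneNP.…` is the layout-mandated namespace

namespace Summit.PneNP.PneNP.Theorems.MonotoneBlind.VertexCover

open Literature.Computability.Complexity Literature.Probability.RandomGraphs.PlantedClique Filter Finset
open scoped ENNReal Topology Classical

variable {n : ℕ}

/-! ### The advantage count at one `n` -/

/-- **The advantage count.** Under three numeric hypotheses on `n`, `d = min k n` and a width cut-off `w`
(all eventually true for `k = ⌈n^{1/2-δ}⌉`, `w = (c + 2r)(⌊log₂ n⌋ + 1)`, `r = C(2c+2, 2)`), and `#𝓔 ≤ n^c`: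
the number `T` of pairs `(A, x)` (planted set, noise) at which the DNF fails on `x` but accepts `plant A x`
satisfies `T · n ≤ #kSubsets · #EdgeVec`, i.e. the planted-minus-null advantage is `≤ 1/n`. Proof: swap the
double count, apply `card_filter_plant_exists_mul_pow_le` at every failure point (`m + 1 = 2c + 2`), bound the
pair count by `sum_card_minimals_filter_mul_le`, and absorb: `d² · polylog · n^{2c+2} + d^{2c+3} n^{c+1} ≤ n^{2c+3}`.
[folklore] -/
theorem sum_card_adv_mul_le (hn : 0 < n) (k c w : ℕ) (𝓔 : Finset (Finset (⊤ : SimpleGraph (Fin n)).edgeSet))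
    (hM : #𝓔 ≤ n ^ c)
    (H1 : 2 * ((min k n) ^ 2 * ((2 * w + 1) ^ (2 * (2 * c + 2).choose 2) + 1)) ≤ n)
    (H2 : 2 * ((min k n) ^ (2 * c + 3) * n ^ (c + 1)) ≤ n ^ (2 * c + 3))
    (H3 : n ^ c * (n + 1) ^ (2 * (2 * c + 2).choose 2) ≤ 2 ^ (w + 1)) :
    (∑ A ∈ kSubsets n k, #(univ.filter fun x : EdgeVec n =>
        (¬ ∃ E ∈ 𝓔, ∀ e ∈ E, x e = true) ∧ ∃ E ∈ 𝓔, ∀ e ∈ E, plant A x e = true)) * n ≤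
      #(kSubsets n k) * Fintype.card (EdgeVec n) := by
  set KS := kSubsets n k with hKS
  set d := min k n with hd
  set r := (2 * c + 2).choose 2 with hr
  set g := (2 * w + 1) ^ (2 * r) + 1 with hg
  set N := Fintype.card (EdgeVec n) with hN
  set Sc := univ.filter (fun x : EdgeVec n => ¬ ∃ E ∈ 𝓔, ∀ e ∈ E, x e = true) with hSc
  set F : EdgeVec n → Finset (Finset (Fin n)) := fun x =>
    (Razborov.minimals (𝓔.image fun E => univ.filter fun v : Fin n =>
      ∃ e : (⊤ : SimpleGraph (Fin n)).edgeSet, e ∈ E.filter (fun e => x e = false) ∧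
        v ∈ (e : Sym2 (Fin n)))).filter fun U => #U ≤ 2 * c + 1 + 1 with hF
  set P := ∑ x ∈ Sc, #(F x) with hP
  set T := ∑ A ∈ KS, #(univ.filter fun x : EdgeVec n =>
    (¬ ∃ E ∈ 𝓔, ∀ e ∈ E, x e = true) ∧ ∃ E ∈ 𝓔, ∀ e ∈ E, plant A x e = true) with hT
  -- Step 1: swap the double count
  have hTswap : T = ∑ x ∈ Sc, #(KS.filter fun A => ∃ E ∈ 𝓔, ∀ e ∈ E, plant A x e = true) := by
    rw [hT]
    simp only [card_filter]
    rw [sum_comm (s := KS) (t := (univ : Finset (EdgeVec n))), hSc, sum_filter]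
    refine sum_congr rfl fun x _ => ?_
    by_cases h : ∃ E ∈ 𝓔, ∀ e ∈ E, x e = true
    · rw [if_neg (not_not.2 h)]
      refine sum_eq_zero fun A _ => if_neg ?_
      exact fun hh => hh.1 h
    · rw [if_pos h]
      refine sum_congr rfl fun A _ => ?_
      by_cases hP : ∃ E ∈ 𝓔, ∀ e ∈ E, plant A x e = true
      · rw [if_pos ⟨h, hP⟩, if_pos hP]
      · rw [if_neg (fun hh => hP hh.2), if_neg hP]
  -- Step 2: the per-failure-point bound, summed
  have hstep2 : T * n ^ (2 * c + 3) ≤ #KS * (d ^ 2 * n ^ (2 * c + 1) * P + d ^ (2 * c + 3) * #𝓔 * N) := by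
    rw [hTswap, sum_mul]
    calc ∑ x ∈ Sc, #(KS.filter fun A => ∃ E ∈ 𝓔, ∀ e ∈ E, plant A x e = true) * n ^ (2 * c + 3)
        ≤ ∑ x ∈ Sc, #KS * (d ^ 2 * n ^ (2 * c + 1) * #(F x) + d ^ (2 * c + 3) * #𝓔) := by
          refine sum_le_sum fun x hx => ?_
          rw [hSc, mem_filter] at hx
          exact card_filter_plant_exists_mul_pow_le k (2 * c + 1) 𝓔 x hx.2
      _ = #KS * (d ^ 2 * n ^ (2 * c + 1) * P + d ^ (2 * c + 3) * #𝓔 * #Sc) := by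
          rw [← mul_sum, sum_add_distrib, ← mul_sum, sum_const, smul_eq_mul, ← hP]
          ring
      _ ≤ #KS * (d ^ 2 * n ^ (2 * c + 1) * P + d ^ (2 * c + 3) * #𝓔 * N) := by
          gcongr
          exact card_le_univ _
  -- Step 3: the pair count, with the heavy accepted points absorbed by `H3`
  have hstep3 : P ≤ N * g := by
    have h := sum_card_minimals_filter_mul_le 𝓔 (2 * c + 1) w
    have h3 : #𝓔 * (n + 1) ^ (2 * r) ≤ 2 ^ (w + 1) := (Nat.mul_le_mul_right _ hM).trans H3
    refine Nat.le_of_mul_le_mul_right ?_ (pow_pos two_pos (w + 1))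
    calc P * 2 ^ (w + 1) ≤ N * ((2 * w + 1) ^ (2 * r) * 2 ^ (w + 1) + #𝓔 * (n + 1) ^ (2 * r)) := h
      _ ≤ N * ((2 * w + 1) ^ (2 * r) * 2 ^ (w + 1) + 2 ^ (w + 1)) := by gcongr
      _ = N * g * 2 ^ (w + 1) := by rw [hg]; ring
  -- Step 4: absorb
  have h1 : 2 * (d ^ 2 * n ^ (2 * c + 1) * (N * g) * n) ≤ N * n ^ (2 * c + 3) := by
    calc 2 * (d ^ 2 * n ^ (2 * c + 1) * (N * g) * n) = 2 * (d ^ 2 * g) * (N * n ^ (2 * c + 1) * n) := by ring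
      _ ≤ n * (N * n ^ (2 * c + 1) * n) := Nat.mul_le_mul_right _ H1
      _ = N * n ^ (2 * c + 3) := by ring
  have h2 : 2 * (d ^ (2 * c + 3) * n ^ c * N * n) ≤ N * n ^ (2 * c + 3) := by
    calc 2 * (d ^ (2 * c + 3) * n ^ c * N * n) = 2 * (d ^ (2 * c + 3) * n ^ (c + 1)) * N := by ring
      _ ≤ n ^ (2 * c + 3) * N := Nat.mul_le_mul_right _ H2
      _ = N * n ^ (2 * c + 3) := by ring
  have hsum : d ^ 2 * n ^ (2 * c + 1) * (N * g) * n + d ^ (2 * c + 3) * n ^ c * N * n ≤ N * n ^ (2 * c + 3) := by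
    omega
  have hfin : T * n ^ (2 * c + 3) * n ≤ #KS * N * n ^ (2 * c + 3) := by
    calc T * n ^ (2 * c + 3) * n ≤ #KS * (d ^ 2 * n ^ (2 * c + 1) * P + d ^ (2 * c + 3) * #𝓔 * N) * n :=
          Nat.mul_le_mul_right _ hstep2
      _ ≤ #KS * (d ^ 2 * n ^ (2 * c + 1) * (N * g) + d ^ (2 * c + 3) * n ^ c * N) * n := by gcongr
      _ = #KS * (d ^ 2 * n ^ (2 * c + 1) * (N * g) * n + d ^ (2 * c + 3) * n ^ c * N * n) := by ring
      _ ≤ #KS * (N * n ^ (2 * c + 3)) := Nat.mul_le_mul_left _ hsum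
      _ = #KS * N * n ^ (2 * c + 3) := by ring
  refine Nat.le_of_mul_le_mul_right ?_ (pow_pos hn (2 * c + 3))
  calc T * n * n ^ (2 * c + 3) = T * n ^ (2 * c + 3) * n := by ring
    _ ≤ #KS * N * n ^ (2 * c + 3) := hfin

/-! ### From counts to probabilities -/

/-- **Planted ≤ null + advantage.** For every planted set `A`, `{x | plant A x accepted} ⊆ {accepted} ∪
{x rejected, plant A x accepted}`; average over `A` (`plantedCliqueDist_toOuterMeasure_eq_sum`). [folklore] -/
theorem planted_le_null_add_adv (k : ℕ) (𝓔 : Finset (Finset (⊤ : SimpleGraph (Fin n)).edgeSet)) :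
    (plantedCliqueDist n k).toOuterMeasure {x | ∃ E ∈ 𝓔, ∀ e ∈ E, x e = true} ≤
      (erdosRenyiHalf n).toOuterMeasure {x | ∃ E ∈ 𝓔, ∀ e ∈ E, x e = true} +
        ((#(kSubsets n k) : ℕ) : ℝ≥0∞)⁻¹ * ∑ A ∈ kSubsets n k, (erdosRenyiHalf n).toOuterMeasure
          {x | (¬ ∃ E ∈ 𝓔, ∀ e ∈ E, x e = true) ∧ ∃ E ∈ 𝓔, ∀ e ∈ E, plant A x e = true} := by
  set P0 := erdosRenyiHalf n with hP0
  set μ := P0.toOuterMeasure {x | ∃ E ∈ 𝓔, ∀ e ∈ E, x e = true} with hμ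
  have hne := card_kSubsets_cast_ne_zero n k
  have htop : ((#(kSubsets n k) : ℕ) : ℝ≥0∞) ≠ ⊤ := ENNReal.natCast_ne_top _
  have hA : ∀ A : Finset (Fin n),
      P0.toOuterMeasure {x | plant A x ∈ {x : EdgeVec n | ∃ E ∈ 𝓔, ∀ e ∈ E, x e = true}} ≤
        μ + P0.toOuterMeasure
          {x | (¬ ∃ E ∈ 𝓔, ∀ e ∈ E, x e = true) ∧ ∃ E ∈ 𝓔, ∀ e ∈ E, plant A x e = true} := by
    intro A
    refine le_trans (P0.toOuterMeasure.mono fun x hx => ?_) (MeasureTheory.measure_union_le _ _)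
    simp only [Set.mem_setOf_eq] at hx
    by_cases h : ∃ E ∈ 𝓔, ∀ e ∈ E, x e = true
    · exact Or.inl h
    · exact Or.inr ⟨h, hx⟩
  rw [plantedCliqueDist_toOuterMeasure_eq_sum]
  calc ((#(kSubsets n k) : ℕ) : ℝ≥0∞)⁻¹ * ∑ A ∈ kSubsets n k, P0.toOuterMeasure
          {x | plant A x ∈ {x : EdgeVec n | ∃ E ∈ 𝓔, ∀ e ∈ E, x e = true}}
      ≤ ((#(kSubsets n k) : ℕ) : ℝ≥0∞)⁻¹ * ∑ A ∈ kSubsets n k, (μ + P0.toOuterMeasure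
          {x | (¬ ∃ E ∈ 𝓔, ∀ e ∈ E, x e = true) ∧ ∃ E ∈ 𝓔, ∀ e ∈ E, plant A x e = true}) := by
        gcongr with A hA'
        exact hA A
    _ = μ + ((#(kSubsets n k) : ℕ) : ℝ≥0∞)⁻¹ * ∑ A ∈ kSubsets n k, P0.toOuterMeasure
          {x | (¬ ∃ E ∈ 𝓔, ∀ e ∈ E, x e = true) ∧ ∃ E ∈ 𝓔, ∀ e ∈ E, plant A x e = true} := by
        rw [sum_add_distrib, sum_const, nsmul_eq_mul, mul_add, ← mul_assoc, ENNReal.inv_mul_cancel hne htop,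
          one_mul]

/-- **Advantage ≤ 1/n from the count.** The advantage is `(#kSubsets)⁻¹ (#EdgeVec)⁻¹ T` with `T` the pair count
of `sum_card_adv_mul_le`; `T n ≤ #kSubsets · #EdgeVec` makes it `≤ n⁻¹`. [folklore] -/
theorem adv_le_inv_of_count (hn : 0 < n) (k : ℕ) (𝓔 : Finset (Finset (⊤ : SimpleGraph (Fin n)).edgeSet))
    (h : (∑ A ∈ kSubsets n k, #(univ.filter fun x : EdgeVec n =>
        (¬ ∃ E ∈ 𝓔, ∀ e ∈ E, x e = true) ∧ ∃ E ∈ 𝓔, ∀ e ∈ E, plant A x e = true)) * n ≤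
      #(kSubsets n k) * Fintype.card (EdgeVec n)) :
    ((#(kSubsets n k) : ℕ) : ℝ≥0∞)⁻¹ * ∑ A ∈ kSubsets n k, (erdosRenyiHalf n).toOuterMeasure
        {x | (¬ ∃ E ∈ 𝓔, ∀ e ∈ E, x e = true) ∧ ∃ E ∈ 𝓔, ∀ e ∈ E, plant A x e = true} ≤
      ((n : ℕ) : ℝ≥0∞)⁻¹ := by
  have hne := card_kSubsets_cast_ne_zero n k
  have htop : ((#(kSubsets n k) : ℕ) : ℝ≥0∞) ≠ ⊤ := ENNReal.natCast_ne_top _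
  set T := ∑ A ∈ kSubsets n k, #(univ.filter fun x : EdgeVec n =>
    (¬ ∃ E ∈ 𝓔, ∀ e ∈ E, x e = true) ∧ ∃ E ∈ 𝓔, ∀ e ∈ E, plant A x e = true) with hT
  have hsum : ∑ A ∈ kSubsets n k, (erdosRenyiHalf n).toOuterMeasure
      {x | (¬ ∃ E ∈ 𝓔, ∀ e ∈ E, x e = true) ∧ ∃ E ∈ 𝓔, ∀ e ∈ E, plant A x e = true} =
      (T : ℝ≥0∞) * ((Fintype.card (EdgeVec n) : ℕ) : ℝ≥0∞)⁻¹ := by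
    rw [hT, Nat.cast_sum, sum_mul]
    refine sum_congr rfl fun A _ => ?_
    rw [erdosRenyiHalf_toOuterMeasure_eq_card_div, div_eq_mul_inv]
    simp only [Set.mem_setOf_eq]
  rw [hsum]
  have key := natCast_div_le_inv_of_mul_le h hn.ne'
  rw [Nat.cast_mul, div_eq_mul_inv, ENNReal.mul_inv (Or.inl hne) (Or.inl htop)] at key
  calc ((#(kSubsets n k) : ℕ) : ℝ≥0∞)⁻¹ * ((T : ℝ≥0∞) * ((Fintype.card (EdgeVec n) : ℕ) : ℝ≥0∞)⁻¹)
      = (T : ℝ≥0∞) * (((#(kSubsets n k) : ℕ) : ℝ≥0∞)⁻¹ * ((Fintype.card (EdgeVec n) : ℕ) : ℝ≥0∞)⁻¹) :=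
        mul_left_comm _ _ _
    _ ≤ ((n : ℕ) : ℝ≥0∞)⁻¹ := key

/-! ### The numeric hypotheses, eventually -/

/-- **H3 always**: `n^c (n+1)^{2r} ≤ 2^{(c+2r)(⌊log₂ n⌋+1)+1}` (as `n + 1 ≤ 2^{⌊log₂ n⌋+1}`). [folklore] -/
theorem weakBlindDnf_H3 (n c r : ℕ) : n ^ c * (n + 1) ^ (2 * r) ≤ 2 ^ ((c + 2 * r) * (Nat.log 2 n + 1) + 1) := by
  have h1 : n + 1 ≤ 2 ^ (Nat.log 2 n + 1) := Nat.lt_pow_succ_log_self one_lt_two n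
  calc n ^ c * (n + 1) ^ (2 * r) ≤ (n + 1) ^ c * (n + 1) ^ (2 * r) :=
        Nat.mul_le_mul_right _ (Nat.pow_le_pow_left (Nat.le_succ n) _)
    _ = (n + 1) ^ (c + 2 * r) := by rw [← pow_add]
    _ ≤ (2 ^ (Nat.log 2 n + 1)) ^ (c + 2 * r) := Nat.pow_le_pow_left h1 _
    _ = 2 ^ ((c + 2 * r) * (Nat.log 2 n + 1)) := by rw [← pow_mul, mul_comm]
    _ ≤ 2 ^ ((c + 2 * r) * (Nat.log 2 n + 1) + 1) := Nat.pow_le_pow_right two_pos (Nat.le_succ _)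

/-- **H2 eventually**: `2 d^{2c+3} n^{c+1} ≤ n^{2c+3}` for `d = min(⌈n^{1/2-δ}⌉, n)` (exponent gap
`1/2 + δ(2c+3) > 0`). [folklore] -/
theorem eventually_weakBlindDnf_H2 {δ : ℝ} (hδ : 0 < δ) (hδ' : δ < 1 / 2) (c : ℕ) :
    ∀ᶠ n : ℕ in atTop, 2 * ((min ⌈(n : ℝ) ^ (1 / 2 - δ)⌉₊ n) ^ (2 * c + 3) * n ^ (c + 1)) ≤ n ^ (2 * c + 3) := by
  have hgap : ((2 * c + 3 : ℕ) : ℝ) * (1 / 2 - δ) + ((c + 1 : ℕ) : ℝ) < ((2 * c + 3 : ℕ) : ℝ) := by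
    have hc : (0 : ℝ) ≤ c := Nat.cast_nonneg c
    push_cast
    nlinarith
  have hev := eventually_const_mul_log_pow_mul_rpow_le (2 * (2 : ℝ) ^ (2 * c + 3)) 0 hgap
  filter_upwards [hev, eventually_ge_atTop 1] with n h hn1
  have hnR : (0 : ℝ) < n := by exact_mod_cast hn1
  have hd := min_ceil_rpow_le hδ' hn1
  set dd := min ⌈(n : ℝ) ^ (1 / 2 - δ)⌉₊ n with hdd
  have hpow : ((n : ℝ) ^ (1 / 2 - δ)) ^ (2 * c + 3) * (n : ℝ) ^ (c + 1) =
      (n : ℝ) ^ (((2 * c + 3 : ℕ) : ℝ) * (1 / 2 - δ) + ((c + 1 : ℕ) : ℝ)) := by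
    rw [← Real.rpow_natCast, ← Real.rpow_mul hnR.le, ← Real.rpow_natCast, ← Real.rpow_add hnR]
    congr 1; push_cast; ring
  have hreal : ((2 * (dd ^ (2 * c + 3) * n ^ (c + 1)) : ℕ) : ℝ) ≤ (n : ℝ) ^ (2 * c + 3) := by
    push_cast
    calc (2 * ((dd : ℝ) ^ (2 * c + 3) * (n : ℝ) ^ (c + 1)) : ℝ)
        ≤ 2 * ((2 * (n : ℝ) ^ (1 / 2 - δ)) ^ (2 * c + 3) * (n : ℝ) ^ (c + 1)) := by gcongr
      _ = 2 * 2 ^ (2 * c + 3) * Real.log n ^ 0 * (((n : ℝ) ^ (1 / 2 - δ)) ^ (2 * c + 3) * (n : ℝ) ^ (c + 1)) := by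
          rw [mul_pow, pow_zero]; ring
      _ = 2 * 2 ^ (2 * c + 3) * Real.log n ^ 0 * (n : ℝ) ^ (((2 * c + 3 : ℕ) : ℝ) * (1 / 2 - δ) + ((c + 1 : ℕ) : ℝ)) := by
          rw [hpow]
      _ ≤ (n : ℝ) ^ ((2 * c + 3 : ℕ) : ℝ) := h
      _ = (n : ℝ) ^ (2 * c + 3) := Real.rpow_natCast _ _
  exact_mod_cast hreal

/-- **H1 eventually**: `2 d² ((2w+1)^{2r} + 1) ≤ n` for `d = min(⌈n^{1/2-δ}⌉, n)`, `w = (c+2r)(⌊log₂ n⌋+1)`,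
`r = C(2c+2, 2)` (`d² = O(n^{1-2δ})`, the bracket is polylogarithmic). [folklore] -/
theorem eventually_weakBlindDnf_H1 {δ : ℝ} (hδ : 0 < δ) (hδ' : δ < 1 / 2) (c : ℕ) :
    ∀ᶠ n : ℕ in atTop, 2 * ((min ⌈(n : ℝ) ^ (1 / 2 - δ)⌉₊ n) ^ 2 *
        ((2 * ((c + 2 * (2 * c + 2).choose 2) * (Nat.log 2 n + 1)) + 1) ^ (2 * (2 * c + 2).choose 2) + 1)) ≤ n := by
  set r := (2 * c + 2).choose 2 with hr
  set a := c + 2 * r with ha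
  set K : ℝ := 2 * (3 * a + 1) with hK
  have hr0 : 2 * r ≠ 0 := by
    have : 0 < r := by rw [hr]; exact Nat.choose_pos (by omega)
    omega
  have hgap : (1 - 2 * δ : ℝ) < 1 := by linarith
  have hev := eventually_const_mul_log_pow_mul_rpow_le (8 * K ^ (2 * r)) (2 * r) hgap
  filter_upwards [hev, eventually_ge_atTop 3] with n h hn3
  have hn1 : 1 ≤ n := by omega
  have hnR : (0 : ℝ) < n := by exact_mod_cast hn1
  have hd := min_ceil_rpow_le hδ' hn1
  set dd := min ⌈(n : ℝ) ^ (1 / 2 - δ)⌉₊ n with hdd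
  set w := a * (Nat.log 2 n + 1) with hw
  have hlog1 : 1 ≤ Real.log n := by
    rw [← Real.log_exp 1]
    refine Real.log_le_log (Real.exp_pos 1) ?_
    have h3 : (3 : ℝ) ≤ n := by exact_mod_cast hn3
    linarith [Real.exp_one_lt_d9]
  have hL : (Nat.log 2 n : ℝ) ≤ 2 * Real.log n := natLog_two_le_two_mul_log hn1
  have ha0 : (0 : ℝ) ≤ a := Nat.cast_nonneg a
  have hwR : (w : ℝ) = a * ((Nat.log 2 n : ℝ) + 1) := by rw [hw]; push_cast; ring
  have hwK : 2 * (w : ℝ) + 2 ≤ K * Real.log n := by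
    rw [hwR, hK]
    nlinarith
  have hg : (2 * (w : ℝ) + 1) ^ (2 * r) + 1 ≤ (K * Real.log n) ^ (2 * r) := by
    have hlt : (2 * w + 1) ^ (2 * r) + 1 ≤ (2 * w + 2) ^ (2 * r) := Nat.pow_lt_pow_left (by omega) hr0
    have hltR : (2 * (w : ℝ) + 1) ^ (2 * r) + 1 ≤ (2 * (w : ℝ) + 2) ^ (2 * r) := by exact_mod_cast hlt
    exact hltR.trans (pow_le_pow_left₀ (by positivity) hwK _)
  have hsq : ((n : ℝ) ^ (1 / 2 - δ)) * ((n : ℝ) ^ (1 / 2 - δ)) = (n : ℝ) ^ (1 - 2 * δ) := by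
    rw [← Real.rpow_add hnR]; ring_nf
  have hreal : ((2 * (dd ^ 2 * ((2 * w + 1) ^ (2 * r) + 1)) : ℕ) : ℝ) ≤ n := by
    push_cast
    calc (2 * ((dd : ℝ) ^ 2 * ((2 * (w : ℝ) + 1) ^ (2 * r) + 1)) : ℝ)
        ≤ 2 * ((2 * (n : ℝ) ^ (1 / 2 - δ)) ^ 2 * (K * Real.log n) ^ (2 * r)) := by gcongr
      _ = 8 * K ^ (2 * r) * Real.log n ^ (2 * r) * (n : ℝ) ^ (1 - 2 * δ) := by
          rw [mul_pow, mul_pow, ← hsq]; ring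
      _ ≤ (n : ℝ) ^ (1 : ℝ) := h
      _ = n := Real.rpow_one _
  exact_mod_cast hreal

/-! ### The theorem -/

/-- **stub_weakBlindDnf** (stub of line `Sketch` of crux stmt-PneNP-18027; NEW — weak blindness of EVERY
polynomial-term monotone DNF, no quietness). For `δ ∈ (0,1/2)`, `c`, and term families with `#(𝓔 n) ≤ n^c`
eventually: `Pr_planted[∃ E ⊆ y] ≤ Pr_null[∃ E ⊆ x] + 1/n` eventually (so `ε n := n⁻¹ → 0`). Proof: the
advantage is the `(A, x)`-average of `[x rejected, plant A x accepted]` (`planted_le_null_add_adv`); at every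
failure point the completing planted sets are covered by the MINIMAL missing vertex sets (cover + fibre factor,
`card_filter_plant_exists_mul_pow_le`), whose number is polylogarithmic on average by the injection
`(x, U) ↦ (x ∪ (E_U ∖ x), E_U ∖ x)` (`sum_card_minimals_filter_mul_le`); the numeric bookkeeping is
`sum_card_adv_mul_le` under `H1`–`H3`, which hold eventually for `k = ⌈n^{1/2-δ}⌉`. [folklore] -/
theorem stub_weakBlindDnf :
    ∀ δ : ℝ, 0 < δ → δ < 1 / 2 → ∀ c : ℕ,
      ∀ 𝓔 : (n : ℕ) → Finset (Finset ((⊤ : SimpleGraph (Fin n)).edgeSet)),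
      (∀ᶠ n : ℕ in atTop, #(𝓔 n) ≤ n ^ c) →
      ∃ ε : ℕ → ℝ≥0∞, Tendsto ε atTop (𝓝 0) ∧
        ∀ᶠ n : ℕ in atTop,
          (plantedCliqueDist n ⌈(n : ℝ) ^ (1 / 2 - δ)⌉₊).toOuterMeasure
              {x | ∃ E ∈ 𝓔 n, ∀ e ∈ E, x e = true} ≤
            (erdosRenyiHalf n).toOuterMeasure {x | ∃ E ∈ 𝓔 n, ∀ e ∈ E, x e = true} + ε n := by
  intro δ hδ hδ' c 𝓔 hM
  refine ⟨fun n => ((n : ℕ) : ℝ≥0∞)⁻¹, ENNReal.tendsto_inv_nat_nhds_zero, ?_⟩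
  filter_upwards [hM, eventually_weakBlindDnf_H1 hδ hδ' c, eventually_weakBlindDnf_H2 hδ hδ' c,
    eventually_ge_atTop 1] with n hMn H1 H2 hn1
  have hcount := sum_card_adv_mul_le hn1 ⌈(n : ℝ) ^ (1 / 2 - δ)⌉₊ c
    ((c + 2 * (2 * c + 2).choose 2) * (Nat.log 2 n + 1)) (𝓔 n) hMn H1 H2
    (weakBlindDnf_H3 n c ((2 * c + 2).choose 2))
  exact (planted_le_null_add_adv ⌈(n : ℝ) ^ (1 / 2 - δ)⌉₊ (𝓔 n)).trans
    (add_le_add le_rfl (adv_le_inv_of_count hn1 ⌈(n : ℝ) ^ (1 / 2 - δ)⌉₊ (𝓔 n) hcount))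

end Summit.PneNP.PneNP.Theorems.MonotoneBlind.VertexCover
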